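import Mathlib
import HarnessLib
import Summits.AtomisticToContinuum.FouriersLaw.Theorems.HiddenChargeMazurDressedChargeStubHarmonicSymmetriesAux1

/-!
# Harmonic rigidity: no polynomial symmetry of degree `≥ 2` (stub D of crux `DressedCharge`)

Stub `stub_harmonicSymmetries` (D) of line `birth` of the crux
`Summit.AtomisticToContinuum.FouriersLaw.Theses.HiddenChargeMazur.DressedCharge`
(item stmt-AtomisticToContinuum-13509, route `HiddenChargeMazur`), proved verbatim; a `--supports`
file.

Setting (all over `ℂ`, in the lattice phase-space ring `MvPolynomial (ℤ ⊕ ℤ) ℂ`, `q_x = X (inl x)`,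
`p_x = X (inr x)`): for a complex plane wave `(z, μ)` the derivation
`D_(z,μ) = mkDerivation ℂ (q_x ↦ C z^x, p_x ↦ C (μ z^x))`; the wave is ADMISSIBLE when `z ≠ 0` and
`μ² = -ω̃(z)`, `ω̃(z) = ω + 2 - z - z⁻¹` (the squared dispersion of the pinned harmonic chain at
`z = e^{ik}`); for a tuple `P : Fin n → ℂ × ℂ` the iterated derivative
`𝐃_P w = (List.ofFn P).foldr D w = D_{P 0} (⋯ (D_{P (n-1)} w))` and the multiplier
`t(P) = (∑ μ_j)² + ω̃(∏ z_j)`.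

Theorem (`stub_harmonicSymmetries`): if `w` is homogeneous of degree `n ≥ 2` and
`t(P) · constantCoeff (𝐃_P w) = 0` for every admissible `n`-tuple `P`, then `w = 0`.

Proof (slot-by-slot genericity, no Fourier analysis).  By downward induction on the length `m < n`
of an admissible tuple `P` we show `𝐃_P w = 0` (for `m = n - 1` only for the NON-EXCEPTIONAL tuples,
`(∏ z_j, ∑ μ_j) ≠ (1, 0)`); at `m = 0` this is `w = 0`.  Each step feeds the key rigidity lemma
`eq_zero_of_planeWave_eq_zero` of the helper file (if `D_(z,μ) U = 0` for all admissible `(z, μ)`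
with `z` off a finite set, then the homogeneous `U` of positive degree vanishes) with
`U = 𝐃_P w`, which is homogeneous of degree `n - m` because constant-coefficient derivations lower
the degree by one:
* base `m = n - 1`: `U` is a linear form, `D_(z,μ) U` is the constant `constantCoeff (𝐃_{(z,μ)::P} w)`,
  and the multiplier `t((z,μ)::P) = (μ + M)² + ω̃(z Z)` (`Z = ∏ z_j ≠ 0`, `M = ∑ μ_j`) is nonzero for
  all admissible `(z, μ)` with `z` off a finite set (`nonresonant_slot`: its norm
  `t(z,μ) t(z,-μ)` is `z⁻² p(z)` for an explicit quartic `p ≠ 0` as soon as `(Z, M) ≠ (1, 0)`);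
* step `m + 2 ≤ n`: the induction hypothesis at the tuple `(z,μ)::P` gives `D_(z,μ) U = 0` for every
  admissible `(z, μ)` with `z ≠ Z⁻¹` (which makes `(z,μ)::P` non-exceptional).
The hypothesis `ω₂ ≠ 0` of the registered statement is not needed by this argument.
-/

noncomputable section

open MvPolynomial Finsupp
open scoped BigOperators

namespace Summit.AtomisticToContinuum.FouriersLaw.Theorems.DressedCharge

/-- **Non-resonance is generic in one slot.** Fix `Z ≠ 0` and `M` with `(Z, M) ≠ (1, 0)`. Then for
all `z ≠ 0` outside a finite set and every `μ` on the dispersion curve `μ² = -(ω + 2 - z - z⁻¹)`,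
the multiplier `(μ + M)² + (ω + 2 - zZ - (zZ)⁻¹)` is nonzero: its product over the two signs of
`μ` equals `z⁻² p(z)` for the explicit quartic
`p = (1-Z)² X⁴ + (2(1-Z)M² - 4M²) X³ + (M⁴ + 2(1-Z)(1-Z⁻¹) + 4M²(ω+2)) X² + (2M²(1-Z⁻¹) - 4M²) X + (1-Z⁻¹)²`,
which is nonzero (leading coefficient if `Z ≠ 1`, cubic coefficient `-4M²` if `Z = 1`), so it has
finitely many roots. [folklore] -/
theorem nonresonant_slot (ω Z M : ℂ) (hZ : Z ≠ 0) (hZM : ¬ (Z = 1 ∧ M = 0)) :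
    ∃ F : Finset ℂ, ∀ z μ : ℂ, z ≠ 0 → z ∉ F → μ ^ 2 = -(ω + 2 - z - z⁻¹) →
      (μ + M) ^ 2 + (ω + 2 - z * Z - (z * Z)⁻¹) ≠ 0 := by
  classical
  set p : Polynomial ℂ := Polynomial.C ((1 - Z) ^ 2) * Polynomial.X ^ 4 +
      Polynomial.C (2 * (1 - Z) * M ^ 2 - 4 * M ^ 2) * Polynomial.X ^ 3 +
      Polynomial.C (M ^ 4 + 2 * (1 - Z) * (1 - Z⁻¹) + 4 * M ^ 2 * (ω + 2)) * Polynomial.X ^ 2 +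
      Polynomial.C (2 * M ^ 2 * (1 - Z⁻¹) - 4 * M ^ 2) * Polynomial.X +
      Polynomial.C ((1 - Z⁻¹) ^ 2) with hp_def
  have hp0 : p ≠ 0 := by
    intro h0
    by_cases hZ1 : Z = 1
    · have hM : M ≠ 0 := fun hM => hZM ⟨hZ1, hM⟩
      have h3 := congrArg (fun P : Polynomial ℂ => P.coeff 3) h0
      simp only [hp_def, Polynomial.coeff_add, Polynomial.coeff_C_mul_X_pow,
        Polynomial.coeff_C_mul_X, Polynomial.coeff_C, Polynomial.coeff_zero] at h3
      norm_num [hZ1] at h3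
      exact hM h3
    · have h4 := congrArg (fun P : Polynomial ℂ => P.coeff 4) h0
      simp only [hp_def, Polynomial.coeff_add, Polynomial.coeff_C_mul_X_pow,
        Polynomial.coeff_C_mul_X, Polynomial.coeff_C, Polynomial.coeff_zero] at h4
      norm_num at h4
      exact hZ1 (sub_eq_zero.mp h4).symm
  refine ⟨p.roots.toFinset, fun z μ hz hzF hμ ht => ?_⟩
  have hpz : p.eval z ≠ 0 := by
    intro hev
    exact hzF (Multiset.mem_toFinset.mpr ((Polynomial.mem_roots hp0).mpr hev))
  have hω : ω = -μ ^ 2 - 2 + z + z⁻¹ := by linear_combination hμ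
  have hid : p.eval z = z ^ 2 * (((μ + M) ^ 2 + (ω + 2 - z * Z - (z * Z)⁻¹)) *
      ((-μ + M) ^ 2 + (ω + 2 - z * Z - (z * Z)⁻¹))) := by
    simp only [hp_def, Polynomial.eval_add, Polynomial.eval_mul, Polynomial.eval_C,
      Polynomial.eval_pow, Polynomial.eval_X]
    rw [hω]
    field_simp
    ring
  rw [hid, ht, zero_mul, mul_zero] at hpz
  exact hpz rfl

/-- The iterated plane-wave derivative `(l.foldr D w)` of a homogeneous `w` of degree `n` along a
list `l` of waves is homogeneous of degree `n - l.length` (each `D_(z,μ)` has constant values on the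
generators, hence lowers the degree by one). [folklore] -/
theorem isHomogeneous_foldr_planeWave (l : List (ℂ × ℂ)) {w : MvPolynomial (ℤ ⊕ ℤ) ℂ} {n : ℕ}
    (hw : w.IsHomogeneous n) :
    (l.foldr (fun (Pj : ℂ × ℂ) (acc : MvPolynomial (ℤ ⊕ ℤ) ℂ) =>
        mkDerivation ℂ (Sum.elim (fun x : ℤ => (C (Pj.1 ^ x) : MvPolynomial (ℤ ⊕ ℤ) ℂ))
          (fun x : ℤ => C (Pj.2 * Pj.1 ^ x))) acc) w).IsHomogeneous (n - l.length) := by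
  induction l with
  | nil => simpa using hw
  | cons Pj l ih =>
    rw [List.foldr_cons, List.length_cons]
    have e : n - l.length - 1 = n - (l.length + 1) := by omega
    rw [← e]
    refine isHomogeneous_derivation_of_const _
      (Sum.elim (fun x : ℤ => Pj.1 ^ x) (fun x : ℤ => Pj.2 * Pj.1 ^ x)) (fun i => ?_) ih
    rw [mkDerivation_X]
    cases i <;> rfl

/-- Consing an admissible wave in front of an admissible tuple gives an admissible tuple.
[folklore] -/
theorem planeWave_cons_admissible (ω : ℂ) {m : ℕ} (P : Fin m → ℂ × ℂ)
    (hP : ∀ j, (P j).1 ≠ 0 ∧ (P j).2 ^ 2 = -(ω + 2 - (P j).1 - ((P j).1)⁻¹)) (z μ : ℂ)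
    (hz : z ≠ 0) (hμ : μ ^ 2 = -(ω + 2 - z - z⁻¹)) :
    ∀ j, ((Fin.cons (z, μ) P : Fin (m + 1) → ℂ × ℂ) j).1 ≠ 0 ∧
      ((Fin.cons (z, μ) P : Fin (m + 1) → ℂ × ℂ) j).2 ^ 2 =
        -(ω + 2 - ((Fin.cons (z, μ) P : Fin (m + 1) → ℂ × ℂ) j).1 -
          (((Fin.cons (z, μ) P : Fin (m + 1) → ℂ × ℂ) j).1)⁻¹) := by
  intro j
  refine Fin.cases ?_ (fun i => ?_) j
  · simp only [Fin.cons_zero]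
    exact ⟨hz, hμ⟩
  · simp only [Fin.cons_succ]
    exact hP i

/-- **The slot induction.** Under the hypothesis of `stub_harmonicSymmetries` (with a complex
parameter `ω`), for every `k` and every admissible tuple `P` of length `m` with `m + k + 1 = n`
— non-exceptional, `(∏ z_j, ∑ μ_j) ≠ (1, 0)`, when `m + 1 = n` — the iterated plane-wave
derivative `𝐃_P w` vanishes.  Induction on `k`: the base `k = 0` uses `nonresonant_slot`, the
step uses the induction hypothesis at the tuples `(z, μ) :: P` with `z ≠ (∏ z_j)⁻¹`; both feed
`eq_zero_of_planeWave_eq_zero`. [folklore] -/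
theorem foldr_planeWave_eq_zero_of_multiplier (ω : ℂ) (n : ℕ) (hn : 2 ≤ n)
    (w : MvPolynomial (ℤ ⊕ ℤ) ℂ) (hw : w.IsHomogeneous n)
    (H : ∀ P : Fin n → ℂ × ℂ, (∀ j, (P j).1 ≠ 0 ∧ (P j).2 ^ 2 = -(ω + 2 - (P j).1 - ((P j).1)⁻¹)) →
      ((∑ j, (P j).2) ^ 2 + (ω + 2 - (∏ j, (P j).1) - (∏ j, (P j).1)⁻¹)) *
        constantCoeff ((List.ofFn P).foldr (fun (Pj : ℂ × ℂ) (acc : MvPolynomial (ℤ ⊕ ℤ) ℂ) =>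
          mkDerivation ℂ (Sum.elim (fun x : ℤ => (C (Pj.1 ^ x) : MvPolynomial (ℤ ⊕ ℤ) ℂ))
            (fun x : ℤ => C (Pj.2 * Pj.1 ^ x))) acc) w) = 0)
    (k : ℕ) : ∀ m : ℕ, m + k + 1 = n → ∀ P : Fin m → ℂ × ℂ,
      (∀ j, (P j).1 ≠ 0 ∧ (P j).2 ^ 2 = -(ω + 2 - (P j).1 - ((P j).1)⁻¹)) →
      (m + 1 = n → ¬ ((∏ j, (P j).1) = 1 ∧ (∑ j, (P j).2) = 0)) →
      (List.ofFn P).foldr (fun (Pj : ℂ × ℂ) (acc : MvPolynomial (ℤ ⊕ ℤ) ℂ) =>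
          mkDerivation ℂ (Sum.elim (fun x : ℤ => (C (Pj.1 ^ x) : MvPolynomial (ℤ ⊕ ℤ) ℂ))
            (fun x : ℤ => C (Pj.2 * Pj.1 ^ x))) acc) w = 0 := by
  induction k with
  | zero =>
    intro m hm P hP hexc
    obtain rfl : n = m + 1 := by omega
    have hU := isHomogeneous_foldr_planeWave (List.ofFn P) hw
    rw [List.length_ofFn, Nat.add_sub_cancel_left] at hU
    have hZ : ∏ j, (P j).1 ≠ 0 := Finset.prod_ne_zero_iff.mpr (fun j _ => (hP j).1)
    obtain ⟨F, hF⟩ := nonresonant_slot ω (∏ j, (P j).1) (∑ j, (P j).2) hZ (hexc rfl)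
    refine eq_zero_of_planeWave_eq_zero ω hU one_ne_zero F (fun z μ hz hzF hμ => ?_)
    have hadm := planeWave_cons_admissible ω P hP z μ hz hμ
    -- the hypothesis at the tuple `(z, μ) :: P`
    have hcc : constantCoeff (mkDerivation ℂ
        (Sum.elim (fun x : ℤ => (C (z ^ x) : MvPolynomial (ℤ ⊕ ℤ) ℂ)) (fun x : ℤ => C (μ * z ^ x)))
        ((List.ofFn P).foldr (fun (Pj : ℂ × ℂ) (acc : MvPolynomial (ℤ ⊕ ℤ) ℂ) =>
          mkDerivation ℂ (Sum.elim (fun x : ℤ => (C (Pj.1 ^ x) : MvPolynomial (ℤ ⊕ ℤ) ℂ))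
            (fun x : ℤ => C (Pj.2 * Pj.1 ^ x))) acc) w)) = 0 := by
      have hH := H (Fin.cons (z, μ) P) hadm
      rw [List.ofFn_cons, List.foldr_cons] at hH
      rcases mul_eq_zero.mp hH with h0 | h0
      · exfalso
        apply hF z μ hz hzF hμ
        simpa [Fin.sum_univ_succ, Fin.prod_univ_succ] using h0
      · exact h0
    -- `D_(z,μ) U` is homogeneous of degree `0`, hence the constant `C 0 = 0`
    have h0 := isHomogeneous_derivation_of_const
      (mkDerivation ℂ (Sum.elim (fun x : ℤ => (C (z ^ x) : MvPolynomial (ℤ ⊕ ℤ) ℂ))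
        (fun x : ℤ => C (μ * z ^ x))))
      (Sum.elim (fun x : ℤ => z ^ x) (fun x : ℤ => μ * z ^ x))
      (fun i => by rw [mkDerivation_X]; cases i <;> rfl) hU
    rw [eq_C_of_isHomogeneous_zero h0, hcc, C_0]
  | succ k ih =>
    intro m hm P hP _
    have hU := isHomogeneous_foldr_planeWave (List.ofFn P) hw
    rw [List.length_ofFn] at hU
    have hZ : ∏ j, (P j).1 ≠ 0 := Finset.prod_ne_zero_iff.mpr (fun j _ => (hP j).1)
    refine eq_zero_of_planeWave_eq_zero ω hU (by omega) {(∏ j, (P j).1)⁻¹}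
      (fun z μ hz hzF hμ => ?_)
    have hadm := planeWave_cons_admissible ω P hP z μ hz hμ
    have hIH := ih (m + 1) (by omega) (Fin.cons (z, μ) P) hadm ?_
    · rw [List.ofFn_cons, List.foldr_cons] at hIH
      exact hIH
    · rintro - ⟨hprod, -⟩
      rw [Fin.prod_univ_succ] at hprod
      simp only [Fin.cons_zero, Fin.cons_succ] at hprod
      exact hzF (Finset.mem_singleton.mpr (eq_inv_of_mul_eq_one_left hprod))

/-- **Stub D (`stub_harmonicSymmetries`) of line `birth` of crux `DressedCharge`: harmonic
rigidity.** A homogeneous polynomial `w` of degree `n ≥ 2` on the lattice phase space such that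
`t(P) · constantCoeff (𝐃_P w) = 0` for every admissible `n`-tuple `P` of complex plane waves of
the pinned harmonic chain (`t(P) = (∑ μ_j)² + ω̃(∏ z_j)`, `ω̃(z) = ω₂ + 2 - z - z⁻¹`) vanishes:
the pinned harmonic chain has no polynomial symmetries of degree `≥ 2` in this plane-wave sense.
Specialisation of `foldr_planeWave_eq_zero_of_multiplier` to the empty tuple. [folklore] -/
theorem stub_harmonicSymmetries :
    ∀ (ω₂ : ℝ), ω₂ ≠ 0 → ∀ (n : ℕ), 2 ≤ n → ∀ (w : MvPolynomial (ℤ ⊕ ℤ) ℂ), w.IsHomogeneous n →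
      (∀ P : Fin n → ℂ × ℂ, (∀ j, (P j).1 ≠ 0 ∧ (P j).2 ^ 2 = -((ω₂ : ℂ) + 2 - (P j).1 - ((P j).1)⁻¹)) →
        ((∑ j, (P j).2) ^ 2 + ((ω₂ : ℂ) + 2 - (∏ j, (P j).1) - (∏ j, (P j).1)⁻¹)) * MvPolynomial.constantCoeff ((List.ofFn P).foldr (fun (Pj : ℂ × ℂ) (acc : MvPolynomial (ℤ ⊕ ℤ) ℂ) => MvPolynomial.mkDerivation ℂ (Sum.elim (fun x : ℤ => (MvPolynomial.C (Pj.1 ^ x) : MvPolynomial (ℤ ⊕ ℤ) ℂ)) (fun x : ℤ => MvPolynomial.C (Pj.2 * Pj.1 ^ x))) acc) (w)) = 0) →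
      w = 0 := by
  intro ω₂ _ n hn w hw H
  have key := foldr_planeWave_eq_zero_of_multiplier (ω₂ : ℂ) n hn w hw H (n - 1) 0 (by omega)
    (fun j => j.elim0) (fun j => j.elim0) (fun h => absurd h (by omega))
  simpa using key

end Summit.AtomisticToContinuum.FouriersLaw.Theorems.DressedCharge
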